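import Mathlib
import HarnessLib
import Summits.AtomisticToContinuum.Crystallization.Theorems.FrustratedLawDichotomyAperiodicFrustratedLawGapErgodicInvolution

/-!
# Ergodic reduction for the crux `AperiodicFrustratedLawGap` — invariant modification of a.e.-invariant functions

Route `FrustratedLawDichotomy`, crux `AperiodicFrustratedLawGap` (item `stmt-AtomisticToContinuum-27623`),
registered stub `stub_ergodicReduction` (skeleton `dd3251ad731e`); fourth brick of step D5 (`hErg`), sequel of
`…ErgodicInvolution`.  In the mean-ergodic route (evidence `D5-PLAN.md`, step D5d/D5e) the `L²`-limits of the
re-rooting averages are only ALMOST invariant; to place them in the re-rooting-invariant σ-algebra `𝓘` one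
needs EXACTLY invariant versions.  Null saturation by mass transport:

* `reroot_zero`, `sub_mem_reroot`, `reroot_reroot_sub` — re-rooting algebra (`S − 0 = S`,
  `(S − y') − (y − y') = S − y`);
* `measure_saturation_eq_zero` — if `N` is a `ν`-null measurable set of configurations and `ν` has a
  Campbell measure invariant under re-rooting, then the SATURATION `{S | ∃ y ∈ S, S − y ∈ N}` (measurable,
  re-rooting invariant, `⊇ N`) is `ν`-null;
* `exists_invariant_ae_eq` — a measurable function which is invariant along `ν ⊗ₘ κ₀`-almost every edge
  `(S, y)` (`f(S − y) = f(S)`) is `ν`-a.e. equal to a measurable EXACTLY invariant function.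

`[folklore]`.
-/

noncomputable section

namespace Summit.AtomisticToContinuum.Crystallization.Theorems.FrustratedLawDichotomyErgodicReduction

open MeasureTheory Set Filter ProbabilityTheory
open scoped ENNReal Classical
open Literature.Probability.Process (LocalConfig)
open Literature.Probability.Process.LocalConfig (RootedHardCoreConfig toMeasure_def measurable_toMeasure)
open Summit.AtomisticToContinuum.Crystallization.Theorems.BenjaminiSchrammLimit (isSFiniteKernel_toMeasure
  measurable_reroot isClosed_incidence)

variable {δ : ℝ}

/-! ### Re-rooting algebra -/

/-- Re-rooting at the root does nothing. [folklore] -/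
theorem reroot_zero (S : RootedHardCoreConfig (EuclideanSpace ℝ (Fin 3)) δ)
    (h : (0 : EuclideanSpace ℝ (Fin 3)) ∈ ((S.1 : LocalConfig (EuclideanSpace ℝ (Fin 3))) : Set (EuclideanSpace ℝ (Fin 3)))) :
    S.reroot 0 h = S := by
  apply Subtype.ext
  show (S.1 : LocalConfig (EuclideanSpace ℝ (Fin 3))).translate 0 = S.1
  exact LocalConfig.translate_zero _

/-- A point `y ∈ S` seen from `y' ∈ S` is the point `y − y'` of `S − y'`. [folklore] -/
theorem sub_mem_reroot (S : RootedHardCoreConfig (EuclideanSpace ℝ (Fin 3)) δ) {y y' : EuclideanSpace ℝ (Fin 3)}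
    (hy : y ∈ ((S.1 : LocalConfig (EuclideanSpace ℝ (Fin 3))) : Set (EuclideanSpace ℝ (Fin 3))))
    (hy' : y' ∈ ((S.1 : LocalConfig (EuclideanSpace ℝ (Fin 3))) : Set (EuclideanSpace ℝ (Fin 3)))) :
    y - y' ∈ (((S.reroot y' hy').1 : LocalConfig (EuclideanSpace ℝ (Fin 3))) : Set (EuclideanSpace ℝ (Fin 3))) := by
  rw [RootedHardCoreConfig.coe_reroot]
  exact ⟨y, hy, rfl⟩

/-- **Re-rooting is transitive**: `(S − y') − (y − y') = S − y`. [folklore] -/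
theorem reroot_reroot_sub (S : RootedHardCoreConfig (EuclideanSpace ℝ (Fin 3)) δ) {y y' : EuclideanSpace ℝ (Fin 3)}
    (hy : y ∈ ((S.1 : LocalConfig (EuclideanSpace ℝ (Fin 3))) : Set (EuclideanSpace ℝ (Fin 3))))
    (hy' : y' ∈ ((S.1 : LocalConfig (EuclideanSpace ℝ (Fin 3))) : Set (EuclideanSpace ℝ (Fin 3))))
    (h : y - y' ∈ (((S.reroot y' hy').1 : LocalConfig (EuclideanSpace ℝ (Fin 3))) : Set (EuclideanSpace ℝ (Fin 3)))) :
    (S.reroot y' hy').reroot (y - y') h = S.reroot y hy := by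
  apply Subtype.ext
  show ((S.1 : LocalConfig (EuclideanSpace ℝ (Fin 3))).translate y').translate (y - y') =
    (S.1 : LocalConfig (EuclideanSpace ℝ (Fin 3))).translate y
  rw [LocalConfig.translate_translate, sub_add_cancel]

/-! ### Null saturation -/

/-- **The saturation of a null set is null** (mass transport).  Let `ν` be an s-finite law on rooted
`δ`-hard-core configurations of `ℝ³` (`δ > 0`) with Campbell measure invariant under the re-rooting involution,
and `N` a measurable `ν`-null set.  Then `ν`-almost every configuration `S` has NO point `y ∈ S` with
`S − y ∈ N`: the set of edges `(S, y)` with `S − y ∈ N` is the `Θ`-preimage of `N × ℝ³`, which is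
`ν ⊗ₘ κ₀`-null. [folklore] -/
theorem ae_forall_reroot_notMem [Fact (0 < δ)]
    {ν : Measure (RootedHardCoreConfig (EuclideanSpace ℝ (Fin 3)) δ)} [SFinite ν]
    (hinv : haveI := isSFiniteKernel_toMeasure (E := EuclideanSpace ℝ (Fin 3)) (δ := δ)
      (ν ⊗ₘ (⟨fun S : RootedHardCoreConfig (EuclideanSpace ℝ (Fin 3)) δ =>
        (S.1 : LocalConfig (EuclideanSpace ℝ (Fin 3))).toMeasure,
        measurable_toMeasure (Fact.out : 0 < δ)⟩ :
        Kernel (RootedHardCoreConfig (EuclideanSpace ℝ (Fin 3)) δ) (EuclideanSpace ℝ (Fin 3)))).map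
      (fun p : RootedHardCoreConfig (EuclideanSpace ℝ (Fin 3)) δ × EuclideanSpace ℝ (Fin 3) =>
        ((if h : p.2 ∈ ((p.1.1 : LocalConfig (EuclideanSpace ℝ (Fin 3))) : Set (EuclideanSpace ℝ (Fin 3)))
          then p.1.reroot p.2 h else p.1 : RootedHardCoreConfig (EuclideanSpace ℝ (Fin 3)) δ), -p.2)) =
      ν ⊗ₘ (⟨fun S : RootedHardCoreConfig (EuclideanSpace ℝ (Fin 3)) δ =>
        (S.1 : LocalConfig (EuclideanSpace ℝ (Fin 3))).toMeasure,
        measurable_toMeasure (Fact.out : 0 < δ)⟩ :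
        Kernel (RootedHardCoreConfig (EuclideanSpace ℝ (Fin 3)) δ) (EuclideanSpace ℝ (Fin 3))))
    {N : Set (RootedHardCoreConfig (EuclideanSpace ℝ (Fin 3)) δ)} (hN : MeasurableSet N) (hνN : ν N = 0) :
    ∀ᵐ S ∂ν, ∀ (y : EuclideanSpace ℝ (Fin 3))
      (hy : y ∈ ((S.1 : LocalConfig (EuclideanSpace ℝ (Fin 3))) : Set (EuclideanSpace ℝ (Fin 3)))),
      S.reroot y hy ∉ N := by
  haveI := isSFiniteKernel_toMeasure (E := EuclideanSpace ℝ (Fin 3)) (δ := δ)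
  have hδ : 0 < δ := Fact.out
  have hΘ : Measurable (fun p : RootedHardCoreConfig (EuclideanSpace ℝ (Fin 3)) δ × EuclideanSpace ℝ (Fin 3) =>
      ((if h : p.2 ∈ ((p.1.1 : LocalConfig (EuclideanSpace ℝ (Fin 3))) : Set (EuclideanSpace ℝ (Fin 3)))
        then p.1.reroot p.2 h else p.1 : RootedHardCoreConfig (EuclideanSpace ℝ (Fin 3)) δ), -p.2)) :=
    measurable_reroot hδ
  set Θ' : RootedHardCoreConfig (EuclideanSpace ℝ (Fin 3)) δ × EuclideanSpace ℝ (Fin 3) →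
      RootedHardCoreConfig (EuclideanSpace ℝ (Fin 3)) δ × EuclideanSpace ℝ (Fin 3) :=
    fun p => ((if h : p.2 ∈ ((p.1.1 : LocalConfig (EuclideanSpace ℝ (Fin 3))) : Set (EuclideanSpace ℝ (Fin 3)))
      then p.1.reroot p.2 h else p.1 : RootedHardCoreConfig (EuclideanSpace ℝ (Fin 3)) δ), -p.2) with hΘ'_def
  -- the cylinder `N × ℝ³` is Campbell-null, hence so is its `Θ`-preimage
  have hcyl : (ν ⊗ₘ (⟨fun S : RootedHardCoreConfig (EuclideanSpace ℝ (Fin 3)) δ =>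
        (S.1 : LocalConfig (EuclideanSpace ℝ (Fin 3))).toMeasure,
        measurable_toMeasure (Fact.out : 0 < δ)⟩ :
        Kernel (RootedHardCoreConfig (EuclideanSpace ℝ (Fin 3)) δ) (EuclideanSpace ℝ (Fin 3))))
      (N ×ˢ (univ : Set (EuclideanSpace ℝ (Fin 3)))) = 0 := by
    rw [Measure.compProd_apply_prod hN MeasurableSet.univ]
    exact setLIntegral_measure_zero _ _ hνN
  have hpre : (ν ⊗ₘ (⟨fun S : RootedHardCoreConfig (EuclideanSpace ℝ (Fin 3)) δ =>
        (S.1 : LocalConfig (EuclideanSpace ℝ (Fin 3))).toMeasure,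
        measurable_toMeasure (Fact.out : 0 < δ)⟩ :
        Kernel (RootedHardCoreConfig (EuclideanSpace ℝ (Fin 3)) δ) (EuclideanSpace ℝ (Fin 3))))
      (Θ' ⁻¹' (N ×ˢ (univ : Set (EuclideanSpace ℝ (Fin 3))))) = 0 := by
    rw [← Measure.map_apply hΘ (hN.prod MeasurableSet.univ), hinv, hcyl]
  -- read it fibrewise
  have hae : ∀ᵐ p ∂(ν ⊗ₘ (⟨fun S : RootedHardCoreConfig (EuclideanSpace ℝ (Fin 3)) δ =>
        (S.1 : LocalConfig (EuclideanSpace ℝ (Fin 3))).toMeasure,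
        measurable_toMeasure (Fact.out : 0 < δ)⟩ :
        Kernel (RootedHardCoreConfig (EuclideanSpace ℝ (Fin 3)) δ) (EuclideanSpace ℝ (Fin 3)))),
      p ∉ Θ' ⁻¹' (N ×ˢ (univ : Set (EuclideanSpace ℝ (Fin 3)))) := compl_mem_ae_iff.2 hpre
  have hae' := Measure.ae_ae_of_ae_compProd hae
  filter_upwards [hae'] with S hS y hy hmem
  have hS' : ∀ᵐ y' ∂((S.1 : LocalConfig (EuclideanSpace ℝ (Fin 3))).toMeasure),
      (S, y') ∉ Θ' ⁻¹' (N ×ˢ (univ : Set (EuclideanSpace ℝ (Fin 3)))) := hS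
  rw [toMeasure_def, ae_restrict_iff' (RootedHardCoreConfig.isClosed_coe hδ S).measurableSet,
    Measure.ae_count_iff] at hS'
  have h := hS' y hy
  simp only [hΘ'_def, mem_preimage, mem_prod, mem_univ, and_true, dif_pos hy] at h
  exact h hmem

/-! ### Exactly invariant modification -/

/-- **A.e.-invariant functions have exactly invariant versions.**  Let `ν` be an s-finite law on rooted
`δ`-hard-core configurations of `ℝ³` (`δ > 0`) with Campbell measure invariant under re-rooting, and
`f` a measurable function into a space with measurable diagonal which is invariant along
`ν ⊗ₘ κ₀`-almost every edge: `f(S − y) = f(S)` for `ν ⊗ₘ κ₀`-a.e. `(S, y)`.  Then there is a measurable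
`f'`, EXACTLY invariant (`f'(S − y) = f'(S)` for all `S` and all `y ∈ S`), with `f' = f` `ν`-a.e.: redefine
`f` as a constant on the (null, invariant) saturation of the bad set. [folklore] -/
theorem exists_invariant_ae_eq [Fact (0 < δ)] {β : Type*} [MeasurableSpace β] [MeasurableEq β]
    [Nonempty β]
    {ν : Measure (RootedHardCoreConfig (EuclideanSpace ℝ (Fin 3)) δ)} [SFinite ν]
    (hinv : haveI := isSFiniteKernel_toMeasure (E := EuclideanSpace ℝ (Fin 3)) (δ := δ)
      (ν ⊗ₘ (⟨fun S : RootedHardCoreConfig (EuclideanSpace ℝ (Fin 3)) δ =>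
        (S.1 : LocalConfig (EuclideanSpace ℝ (Fin 3))).toMeasure,
        measurable_toMeasure (Fact.out : 0 < δ)⟩ :
        Kernel (RootedHardCoreConfig (EuclideanSpace ℝ (Fin 3)) δ) (EuclideanSpace ℝ (Fin 3)))).map
      (fun p : RootedHardCoreConfig (EuclideanSpace ℝ (Fin 3)) δ × EuclideanSpace ℝ (Fin 3) =>
        ((if h : p.2 ∈ ((p.1.1 : LocalConfig (EuclideanSpace ℝ (Fin 3))) : Set (EuclideanSpace ℝ (Fin 3)))
          then p.1.reroot p.2 h else p.1 : RootedHardCoreConfig (EuclideanSpace ℝ (Fin 3)) δ), -p.2)) =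
      ν ⊗ₘ (⟨fun S : RootedHardCoreConfig (EuclideanSpace ℝ (Fin 3)) δ =>
        (S.1 : LocalConfig (EuclideanSpace ℝ (Fin 3))).toMeasure,
        measurable_toMeasure (Fact.out : 0 < δ)⟩ :
        Kernel (RootedHardCoreConfig (EuclideanSpace ℝ (Fin 3)) δ) (EuclideanSpace ℝ (Fin 3))))
    {f : RootedHardCoreConfig (EuclideanSpace ℝ (Fin 3)) δ → β} (hf : Measurable f)
    (hae : ∀ᵐ p ∂(haveI := isSFiniteKernel_toMeasure (E := EuclideanSpace ℝ (Fin 3)) (δ := δ)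
      ν ⊗ₘ (⟨fun S : RootedHardCoreConfig (EuclideanSpace ℝ (Fin 3)) δ =>
        (S.1 : LocalConfig (EuclideanSpace ℝ (Fin 3))).toMeasure,
        measurable_toMeasure (Fact.out : 0 < δ)⟩ :
        Kernel (RootedHardCoreConfig (EuclideanSpace ℝ (Fin 3)) δ) (EuclideanSpace ℝ (Fin 3)))),
      f ((fun p : RootedHardCoreConfig (EuclideanSpace ℝ (Fin 3)) δ × EuclideanSpace ℝ (Fin 3) =>
        ((if h : p.2 ∈ ((p.1.1 : LocalConfig (EuclideanSpace ℝ (Fin 3))) : Set (EuclideanSpace ℝ (Fin 3)))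
          then p.1.reroot p.2 h else p.1 : RootedHardCoreConfig (EuclideanSpace ℝ (Fin 3)) δ), -p.2)) p).1 = f p.1) :
    ∃ f' : RootedHardCoreConfig (EuclideanSpace ℝ (Fin 3)) δ → β, Measurable f' ∧ f' =ᵐ[ν] f ∧
      ∀ (S : RootedHardCoreConfig (EuclideanSpace ℝ (Fin 3)) δ) (y : EuclideanSpace ℝ (Fin 3))
        (hy : y ∈ ((S.1 : LocalConfig (EuclideanSpace ℝ (Fin 3))) : Set (EuclideanSpace ℝ (Fin 3)))),
        f' (S.reroot y hy) = f' S := by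
  haveI := isSFiniteKernel_toMeasure (E := EuclideanSpace ℝ (Fin 3)) (δ := δ)
  have hδ : 0 < δ := Fact.out
  have hΘ : Measurable (fun p : RootedHardCoreConfig (EuclideanSpace ℝ (Fin 3)) δ × EuclideanSpace ℝ (Fin 3) =>
      ((if h : p.2 ∈ ((p.1.1 : LocalConfig (EuclideanSpace ℝ (Fin 3))) : Set (EuclideanSpace ℝ (Fin 3)))
        then p.1.reroot p.2 h else p.1 : RootedHardCoreConfig (EuclideanSpace ℝ (Fin 3)) δ), -p.2)) :=
    measurable_reroot hδ
  set Θ' : RootedHardCoreConfig (EuclideanSpace ℝ (Fin 3)) δ × EuclideanSpace ℝ (Fin 3) →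
      RootedHardCoreConfig (EuclideanSpace ℝ (Fin 3)) δ × EuclideanSpace ℝ (Fin 3) :=
    fun p => ((if h : p.2 ∈ ((p.1.1 : LocalConfig (EuclideanSpace ℝ (Fin 3))) : Set (EuclideanSpace ℝ (Fin 3)))
      then p.1.reroot p.2 h else p.1 : RootedHardCoreConfig (EuclideanSpace ℝ (Fin 3)) δ), -p.2) with hΘ'_def
  -- the bad edges and the bad configurations
  have hD : MeasurableSet {p : RootedHardCoreConfig (EuclideanSpace ℝ (Fin 3)) δ × EuclideanSpace ℝ (Fin 3) |
      f (Θ' p).1 ≠ f p.1} :=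
    (measurableSet_eq_fun (hf.comp hΘ.fst) (hf.comp measurable_fst)).compl
  set N : Set (RootedHardCoreConfig (EuclideanSpace ℝ (Fin 3)) δ) := {S |
      ((S.1 : LocalConfig (EuclideanSpace ℝ (Fin 3))).toMeasure)
        (Prod.mk S ⁻¹' {p : RootedHardCoreConfig (EuclideanSpace ℝ (Fin 3)) δ × EuclideanSpace ℝ (Fin 3) |
          f (Θ' p).1 ≠ f p.1}) ≠ 0} with hN_def
  have hNm : MeasurableSet N := by
    have hmeas : Measurable fun S : RootedHardCoreConfig (EuclideanSpace ℝ (Fin 3)) δ =>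
        (⟨fun S : RootedHardCoreConfig (EuclideanSpace ℝ (Fin 3)) δ =>
          (S.1 : LocalConfig (EuclideanSpace ℝ (Fin 3))).toMeasure,
          measurable_toMeasure (Fact.out : 0 < δ)⟩ :
          Kernel (RootedHardCoreConfig (EuclideanSpace ℝ (Fin 3)) δ) (EuclideanSpace ℝ (Fin 3))) S
          (Prod.mk S ⁻¹' {p : RootedHardCoreConfig (EuclideanSpace ℝ (Fin 3)) δ × EuclideanSpace ℝ (Fin 3) |
            f (Θ' p).1 ≠ f p.1}) :=
      Kernel.measurable_kernel_prodMk_left hD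
    exact (hmeas (measurableSet_singleton 0)).compl
  -- `N` is `ν`-null: fibrewise reading of the a.e. edge invariance
  have hνN : ν N = 0 := by
    have h1 := Measure.ae_ae_of_ae_compProd hae
    rw [← compl_mem_ae_iff]
    filter_upwards [h1] with S hS
    simp only [hN_def, mem_compl_iff, mem_setOf_eq, not_not]
    exact ae_iff.1 hS
  -- the saturation: almost surely no re-rooting lands in `N`
  have hsat := ae_forall_reroot_notMem (δ := δ) hinv hNm hνN
  set M : Set (RootedHardCoreConfig (EuclideanSpace ℝ (Fin 3)) δ) := {S |
      ((S.1 : LocalConfig (EuclideanSpace ℝ (Fin 3))).toMeasure)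
        (Prod.mk S ⁻¹' (Θ' ⁻¹' (N ×ˢ (univ : Set (EuclideanSpace ℝ (Fin 3)))))) ≠ 0} with hM_def
  have hMm : MeasurableSet M := by
    have hmeas : Measurable fun S : RootedHardCoreConfig (EuclideanSpace ℝ (Fin 3)) δ =>
        (⟨fun S : RootedHardCoreConfig (EuclideanSpace ℝ (Fin 3)) δ =>
          (S.1 : LocalConfig (EuclideanSpace ℝ (Fin 3))).toMeasure,
          measurable_toMeasure (Fact.out : 0 < δ)⟩ :
          Kernel (RootedHardCoreConfig (EuclideanSpace ℝ (Fin 3)) δ) (EuclideanSpace ℝ (Fin 3))) S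
          (Prod.mk S ⁻¹' (Θ' ⁻¹' (N ×ˢ (univ : Set (EuclideanSpace ℝ (Fin 3)))))) :=
      Kernel.measurable_kernel_prodMk_left (hΘ (hNm.prod MeasurableSet.univ))
    exact (hmeas (measurableSet_singleton 0)).compl
  -- membership in `M`: some point re-roots into `N`
  have hSmeas : ∀ S : RootedHardCoreConfig (EuclideanSpace ℝ (Fin 3)) δ,
      MeasurableSet ((S.1 : LocalConfig (EuclideanSpace ℝ (Fin 3))) : Set (EuclideanSpace ℝ (Fin 3))) :=
    fun S => (RootedHardCoreConfig.isClosed_coe hδ S).measurableSet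
  have hΘ'1 : ∀ (S : RootedHardCoreConfig (EuclideanSpace ℝ (Fin 3)) δ) (y : EuclideanSpace ℝ (Fin 3))
      (hy : y ∈ ((S.1 : LocalConfig (EuclideanSpace ℝ (Fin 3))) : Set (EuclideanSpace ℝ (Fin 3)))),
      (Θ' (S, y)).1 = S.reroot y hy := fun S y hy => by
    simp only [hΘ'_def]
    rw [dif_pos hy]
  have hM_iff : ∀ S : RootedHardCoreConfig (EuclideanSpace ℝ (Fin 3)) δ, S ∈ M ↔
      ∃ (y : EuclideanSpace ℝ (Fin 3)) (hy : y ∈ ((S.1 : LocalConfig (EuclideanSpace ℝ (Fin 3))) :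
        Set (EuclideanSpace ℝ (Fin 3)))), S.reroot y hy ∈ N := by
    intro S
    have hset : S ∈ M ↔ (Prod.mk S ⁻¹' (Θ' ⁻¹' (N ×ˢ (univ : Set (EuclideanSpace ℝ (Fin 3))))) ∩
        ((S.1 : LocalConfig (EuclideanSpace ℝ (Fin 3))) : Set (EuclideanSpace ℝ (Fin 3)))).Nonempty := by
      show ((S.1 : LocalConfig (EuclideanSpace ℝ (Fin 3))).toMeasure)
          (Prod.mk S ⁻¹' (Θ' ⁻¹' (N ×ˢ (univ : Set (EuclideanSpace ℝ (Fin 3)))))) ≠ 0 ↔ _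
      rw [toMeasure_def, Measure.restrict_apply' (hSmeas S), Ne, Measure.count_eq_zero_iff,
        nonempty_iff_ne_empty]
    rw [hset]
    constructor
    · rintro ⟨y, hy1, hy2⟩
      have h1 : (Θ' (S, y)).1 ∈ N := (mem_prod.1 (mem_preimage.1 (mem_preimage.1 hy1))).1
      rw [hΘ'1 S y hy2] at h1
      exact ⟨y, hy2, h1⟩
    · rintro ⟨y, hy, hyN⟩
      refine ⟨y, ?_, hy⟩
      refine mem_preimage.2 (mem_preimage.2 (mem_prod.2 ⟨?_, mem_univ _⟩))
      rw [hΘ'1 S y hy]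
      exact hyN
  have hNM : N ⊆ M := fun S hS => (hM_iff S).2 ⟨0, S.2.1, by rwa [reroot_zero]⟩
  have hνM : ν M = 0 := by
    rw [← compl_mem_ae_iff]
    filter_upwards [hsat] with S hS hSM
    obtain ⟨y, hy, hyN⟩ := (hM_iff S).1 hSM
    exact hS y hy hyN
  -- `M` is exactly re-rooting invariant
  have hMinv : ∀ (S : RootedHardCoreConfig (EuclideanSpace ℝ (Fin 3)) δ) (y : EuclideanSpace ℝ (Fin 3))
      (hy : y ∈ ((S.1 : LocalConfig (EuclideanSpace ℝ (Fin 3))) : Set (EuclideanSpace ℝ (Fin 3)))),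
      S ∈ M ↔ S.reroot y hy ∈ M := by
    intro S y' hy'
    rw [hM_iff, hM_iff]
    constructor
    · rintro ⟨y, hy, hyN⟩
      exact ⟨y - y', sub_mem_reroot S hy hy', by rwa [reroot_reroot_sub S hy hy']⟩
    · rintro ⟨z, hz, hzN⟩
      have hz' : z + y' ∈ ((S.1 : LocalConfig (EuclideanSpace ℝ (Fin 3))) : Set (EuclideanSpace ℝ (Fin 3))) := by
        rw [RootedHardCoreConfig.coe_reroot] at hz
        obtain ⟨x, hx, rfl⟩ := hz
        rwa [sub_add_cancel]
      refine ⟨z + y', hz', ?_⟩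
      have h := reroot_reroot_sub S hz' hy' (by rwa [add_sub_cancel_right])
      simp only [add_sub_cancel_right] at h
      rwa [h] at hzN
  -- the modification
  obtain ⟨b⟩ := ‹Nonempty β›
  refine ⟨fun S => if S ∈ M then b else f S, Measurable.ite hMm measurable_const hf, ?_, ?_⟩
  · filter_upwards [compl_mem_ae_iff.2 hνM] with S hS
    show (if S ∈ M then b else f S) = f S
    exact if_neg hS
  · intro S y hy
    show (if S.reroot y hy ∈ M then b else f (S.reroot y hy)) = (if S ∈ M then b else f S)
    by_cases hS : S ∈ M
    · rw [if_pos hS, if_pos ((hMinv S y hy).1 hS)]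
    · rw [if_neg hS, if_neg (fun h => hS ((hMinv S y hy).2 h))]
      -- `S ∉ N`: re-rooting at `y` does not change `f`
      have hSN : S ∉ N := fun h => hS (hNM h)
      have hSN' : ((S.1 : LocalConfig (EuclideanSpace ℝ (Fin 3))).toMeasure)
          (Prod.mk S ⁻¹' {p : RootedHardCoreConfig (EuclideanSpace ℝ (Fin 3)) δ × EuclideanSpace ℝ (Fin 3) |
            f (Θ' p).1 ≠ f p.1}) = 0 := by
        by_contra h
        exact hSN h
      rw [toMeasure_def, Measure.restrict_apply' (hSmeas S), Measure.count_eq_zero_iff] at hSN'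
      have hy' : y ∉ Prod.mk S ⁻¹' {p : RootedHardCoreConfig (EuclideanSpace ℝ (Fin 3)) δ ×
          EuclideanSpace ℝ (Fin 3) | f (Θ' p).1 ≠ f p.1} ∩
          ((S.1 : LocalConfig (EuclideanSpace ℝ (Fin 3))) : Set (EuclideanSpace ℝ (Fin 3))) := by
        rw [hSN']
        exact notMem_empty y
      have h : f (Θ' (S, y)).1 = f S := by
        by_contra hne
        exact hy' ⟨hne, hy⟩
      rwa [hΘ'1 S y hy] at h

end Summit.AtomisticToContinuum.Crystallization.Theorems.FrustratedLawDichotomyErgodicReduction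

end
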